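/-
Copyright (c) 2026 the pub-hodgecm-mathlib formalisation cell (harness21).  Prover seat hodgecm-mathlib-K2E1-p02 (g5), Track B ∕ K2-LIT,
h413 = `stmt-HodgeConjecture-24833`, line `K2_E1_TraceFormulaBeta`, campaign RES-RANK-ONE, brick (H2)-e: pseudo-Eisenstein series of data compactly supported
modulo `N` are BOUNDED, by a lattice-point count (no reduction theory).  2026-09-04.
-/
import Summits.HodgeConjecture.HodgeConjecture.Theorems.K2E1PseudoEisensteinUnfolding     -- ★ p856785 (F1): the `θ_Φ` currency, `rational_eq_subgroupOf`
import Literature.NumberTheory.Automorphic.AutomorphicQuotientKernel                      -- ★ house instances `measurableSpaceQuotientForm` …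
import Mathlib.Topology.Algebra.IsUniformGroup.Basic
import Mathlib.Topology.Algebra.Group.Pointwise
import Mathlib.Data.Set.Card
import Mathlib.Data.Real.ENatENNReal
import Mathlib.MeasureTheory.Integral.Lebesgue.Basic
import HarnessLib

/-!
# h413 ∕ Track B «K2-LIT», campaign RES-RANK-ONE, brick (H2)-e — helper `K2E1PseudoEisensteinBounded`:
# `θ_{𝟙_{K₀N}}(x) ≤ #(Γ ∩ C K₀⁻¹ K₀ C⁻¹)` — pseudo-Eisenstein series of indicators of sets compact modulo `N` are bounded, hence square-integrable

Cell `pub/hodgecm-mathlib`, crux H413 = `stmt-HodgeConjecture-24833`, route `HCCMUnconditional`; chair K2-lead (g0), dealer K2E1-plan (g2), JUNCTION RULING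
2026-09-04T03:16:58Z (brick (H2)-e «`θ_{𝟙_S}` is bounded for `S` compact mod `N_i(𝔸)`») with the refinement of K2E1-p02 (g5) 03:23:58Z: the bound is a
LATTICE-POINT COUNT, generic over a discrete `Γ` and a CO-COMPACT `Γ ∩ N` — no Siegel property, no reduction theory.  THEOREMS ONLY (no `def`, no `instance`, no
`notation`, no named-fact hypothesis, no `sorry`); lane `--kind proof --supports stmt-HodgeConjecture-24833 --as helper` (count-neutral).

SETTING of ★ F1∕F3a: `G` a Hausdorff topological group, `Γ ≤ G` DISCRETE, `N ≤ G`, and `Γ ∩ N` co-compact in `N` in the tree's currency (★ F3a `hcov`, ★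
`exists_isCompact_rational_smul_mem_of_eq_three`): a set `C ⊆ N` with `∀ u ∈ N, ∃ δ ∈ Γ ∩ N, δ u ∈ C`.  For `K₀ ⊆ G` and `g ∈ G` consider the cosets
`q ∈ Γ ⧸ Γ∩N` with `g q̃ ∈ K₀ N` — the terms of the pseudo-Eisenstein series `θ_{𝟙_{K₀N}}(gΓ) = Σ'_q 𝟙_{K₀N}(g q̃)` of ★ F1.

* §1 THE COUNT `tsum_indicator_le_encard`: `Σ'_q 𝟙_{K₀N}(g q̃) ≤ #{γ ∈ Γ : γ ∈ C K₀⁻¹ K₀ C⁻¹}` for EVERY `g` (no topology): a coset with `g q̃ = k n` has the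
  representative `γ_q = q̃ δ⁻¹ ∈ Γ` with `g γ_q = k c⁻¹ ∈ K₀ C⁻¹` (`δ n⁻¹ = c ∈ C` by co-compactness), distinct cosets give distinct `γ_q`, and any two such differ by
  `γ_{q₁}⁻¹ γ_q = (g γ_{q₁})⁻¹ (g γ_q) ∈ C K₀⁻¹ K₀ C⁻¹`; `finite_setOf_coe_mem` — a discrete subgroup meets a compact set in a finite set (Mathlib
  `Subgroup.tendsto_coe_cofinite_of_discrete`), so for `C`, `K₀` COMPACT the bound is a natural number `M` independent of `g` (`exists_tsum_indicator_le`).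
* §2 CONSEQUENCES for a Borel `Φ : G → ℂ` right-`N`-invariant with `‖Φ‖ ≤ 𝟙_{K₀N}` (e.g. ★ F3a's tests `Φ = 𝟙_S ∘ π_N`, `S ⊆ π_N(K₀)`:
  `enorm_indicator_comp_mk_le`): `θ_{‖Φ‖} ≤ M` pointwise and **`lintegral_tsum_enorm_sq_lt_top`: `∫⁻_{G⧸Γ} θ_{‖Φ‖}² dμ < ∞`** for any FINITE measure `μ` — `Φ` lies
  in the square-integrable test class `𝒯` of ★ F2b §3 ∕ ★ (H2)-d `K2E1PseudoEisensteinDensity`.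
* §3 ADELIC READING (`𝒢` with `A_G = 1`, `μ` automorphic, `N_i(K)` co-compact in `N_i(𝔸)` in ★ F3b's `hcpt` currency): **`adelic_lintegral_tsum_enorm_sq_lt_top`** —
  every Borel right-`N_i(𝔸)`-invariant `Φ` with `‖Φ‖ ≤ 𝟙_{K₀ N_i(𝔸)}`, `K₀` compact, satisfies `∫⁻_X θ_{‖Φ‖}² dμ < ∞`, i.e. belongs to `𝒯_i`.  This is the input
  that lets ★ F3a∕F3b's cuspidality criterion be cut on the square-integrable test class (F3-c), discharging the hypothesis `hF3` of ★ (H2)-d.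

HONEST LABEL.  Count-neutral helper; proves no printed statement; HC_CM is proved only modulo the 7 printed citations (2 remaining named inputs: hLiu418 =
`stmt-HodgeConjecture-24832`, h413 = `stmt-HodgeConjecture-24833`) until rung 0 closes.

## References
* [MoeglinWaldspurger1995] C. Mœglin, J.-L. Waldspurger, *Spectral decomposition and Eisenstein series* (1995), II.1.1–II.1.2 (pseudo-Eisenstein series of
  compactly supported data), I.2.1 (co-compactness of `N(k)` in `N(𝔸)`).
* [Garrett2018] P. Garrett, *Modern Analysis of Automorphic Forms by Example*, vol. 1 (2018), §1.8 (the sum defining `Ψ_φ` is locally finite).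
* [BorelJacquet1979] A. Borel, H. Jacquet, *Automorphic forms and automorphic representations*, PSPM 33.1 (1979), §4.4.
-/

set_option autoImplicit false
set_option linter.dupNamespace false  -- the mandated namespace repeats the summit's segment (`HodgeConjecture.HodgeConjecture`)

noncomputable section

open MeasureTheory Measure Set Filter Topology
open Literature.NumberTheory.Automorphic
open Summit.HodgeConjecture.HodgeConjecture.Cruxes.H413.K2E1PseudoEisensteinUnfolding
open scoped ENNReal NNReal Pointwise

namespace Summit.HodgeConjecture.HodgeConjecture.Cruxes.H413.K2E1PseudoEisensteinBounded

/-! ## §1 The lattice-point count -/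

section Count

variable {G : Type*} [Group G] (Γ N : Subgroup G)

/-- **THE COUNT.**  For `C ⊆ N` with `N = (Γ ∩ N) · C` (co-compactness currency of ★ F3a), any `K₀ ⊆ G` and any `g ∈ G`:
`Σ'_{q ∈ Γ⧸Γ∩N} 𝟙_{K₀N}(g q̃) ≤ #{γ ∈ Γ : γ ∈ C K₀⁻¹ K₀ C⁻¹}` (in `[0, ∞]`, the right side `⊤` if infinite).  Each coset `q` with `g q̃ = k n ∈ K₀ N` has a representative
`γ_q = q̃ δ⁻¹ ∈ Γ` with `g γ_q ∈ K₀ C⁻¹` (`δ n⁻¹ ∈ C`); `q ↦ γ_{q₁}⁻¹ γ_q` maps these cosets injectively into `Γ ∩ C K₀⁻¹ K₀ C⁻¹`.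
[cite: MoeglinWaldspurger1995, II.1.1] [cite: Garrett2018, §1.8] -/
theorem tsum_indicator_le_encard {C : Set N} (hcov : ∀ u : N, ∃ δ : Γ.subgroupOf N, δ • u ∈ C) (K₀ : Set G) (g : G) :
    ∑' q : Γ ⧸ N.subgroupOf Γ, (K₀ * (N : Set G)).indicator (fun _ => (1 : ℝ≥0∞)) (g * (q.out : G)) ≤
      (({γ : Γ | (γ : G) ∈ (Subtype.val '' C : Set G) * K₀⁻¹ * K₀ * (Subtype.val '' C : Set G)⁻¹} : Set Γ).encard : ℝ≥0∞) := by
  classical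
  -- the set of cosets meeting `K₀ N`, and the sum as its cardinality
  set T : Set (Γ ⧸ N.subgroupOf Γ) := {q | g * (q.out : G) ∈ K₀ * (N : Set G)} with hT
  have hlhs : ∑' q : Γ ⧸ N.subgroupOf Γ, (K₀ * (N : Set G)).indicator (fun _ => (1 : ℝ≥0∞)) (g * (q.out : G)) = T.encard := by
    rw [← ENNReal.tsum_set_one, tsum_subtype T (fun _ => (1 : ℝ≥0∞))]
    refine tsum_congr fun q => ?_
    by_cases hq : g * (q.out : G) ∈ K₀ * (N : Set G)
    · rw [Set.indicator_of_mem hq, Set.indicator_of_mem (show q ∈ T from hq)]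
    · rw [Set.indicator_of_notMem hq, Set.indicator_of_notMem (show q ∉ T from hq)]
  rw [hlhs]
  -- every coset in `T` has a representative `γ` with `g γ ∈ K₀ C⁻¹`
  have key : ∀ q ∈ T, ∃ γ : Γ, (QuotientGroup.mk γ : Γ ⧸ N.subgroupOf Γ) = q ∧ g * (γ : G) ∈ K₀ * (Subtype.val '' C : Set G)⁻¹ := by
    intro q hq
    obtain ⟨k, hk, n, hn, hkn⟩ := Set.mem_mul.1 hq
    obtain ⟨δ, hδ⟩ := hcov (⟨n, hn⟩ : N)⁻¹
    have hδN : (⟨((δ : N) : G), δ.2⟩ : Γ) ∈ N.subgroupOf Γ := (δ : N).2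
    refine ⟨q.out * (⟨((δ : N) : G), δ.2⟩ : Γ)⁻¹, ?_, ?_⟩
    · rw [QuotientGroup.mk_mul_of_mem _ (inv_mem hδN), QuotientGroup.out_eq']
    · have h1 : g * ((q.out * (⟨((δ : N) : G), δ.2⟩ : Γ)⁻¹ : Γ) : G) = k * (((δ • (⟨n, hn⟩ : N)⁻¹ : N) : G))⁻¹ := by
        rw [Subgroup.coe_mul, Subgroup.coe_inv, ← mul_assoc, ← hkn, Subgroup.smul_def, smul_eq_mul, Subgroup.coe_mul, Subgroup.coe_inv,
          mul_inv_rev, inv_inv, mul_assoc]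
      rw [h1]
      exact Set.mul_mem_mul hk (Set.inv_mem_inv.2 ⟨_, hδ, rfl⟩)
  rcases T.eq_empty_or_nonempty with hTe | ⟨q₁, hq₁⟩
  · rw [hTe, Set.encard_empty]
    simp
  obtain ⟨γ₁, -, hγ₁⟩ := key q₁ hq₁
  -- `q ↦ γ₁⁻¹ γ_q` lands in `Γ ∩ C K₀⁻¹ K₀ C⁻¹`, i.e. `T` is covered by the image of that set under `γ' ↦ [γ₁ γ']`
  have hsub : T ⊆ (fun γ' : Γ => (QuotientGroup.mk (γ₁ * γ') : Γ ⧸ N.subgroupOf Γ)) ''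
      {γ : Γ | (γ : G) ∈ (Subtype.val '' C : Set G) * K₀⁻¹ * K₀ * (Subtype.val '' C : Set G)⁻¹} := by
    intro q hq
    obtain ⟨γ, hγq, hγ⟩ := key q hq
    refine ⟨γ₁⁻¹ * γ, ?_, ?_⟩
    · have h2 : ((γ₁⁻¹ * γ : Γ) : G) = (g * (γ₁ : G))⁻¹ * (g * (γ : G)) := by
        rw [Subgroup.coe_mul, Subgroup.coe_inv, mul_inv_rev, mul_assoc, inv_mul_cancel_left]
      have hmem : (g * (γ₁ : G))⁻¹ * (g * (γ : G)) ∈ (K₀ * (Subtype.val '' C : Set G)⁻¹)⁻¹ * (K₀ * (Subtype.val '' C : Set G)⁻¹) :=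
        Set.mul_mem_mul (Set.inv_mem_inv.2 hγ₁) hγ
      rw [mul_inv_rev, inv_inv, ← mul_assoc] at hmem
      simp only [Set.mem_setOf_eq]
      rw [h2]
      exact hmem
    · change (QuotientGroup.mk (γ₁ * (γ₁⁻¹ * γ)) : Γ ⧸ N.subgroupOf Γ) = q
      rw [mul_inv_cancel_left, hγq]
  exact ENat.toENNReal_mono ((Set.encard_le_encard hsub).trans (Set.encard_image_le _ _))

variable [TopologicalSpace G] [IsTopologicalGroup G] [T2Space G] [DiscreteTopology Γ]

/-- **A discrete subgroup meets a compact set in finitely many points** (Mathlib `Subgroup.tendsto_coe_cofinite_of_discrete`: the inclusion `Γ → G` tends to the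
cocompact filter along the cofinite filter). [folklore] -/
theorem finite_setOf_coe_mem {D : Set G} (hD : IsCompact D) : ({γ : Γ | (γ : G) ∈ D} : Set Γ).Finite := by
  have h := Subgroup.tendsto_coe_cofinite_of_discrete Γ (isDiscrete_iff_discreteTopology.mpr ‹DiscreteTopology Γ›) hD.compl_mem_cocompact
  rw [Filter.mem_map, Filter.mem_cofinite, Set.preimage_compl, compl_compl] at h
  exact h

/-- **UNIFORM BOUND**: for `C ⊆ N` COMPACT with `N = (Γ∩N)·C` and `K₀ ⊆ G` COMPACT there is `M < ∞` with `Σ'_q 𝟙_{K₀N}(g q̃) ≤ M` for every `g ∈ G`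
(`M = #(Γ ∩ C K₀⁻¹ K₀ C⁻¹)`, finite since `C K₀⁻¹ K₀ C⁻¹` is compact). [cite: MoeglinWaldspurger1995, II.1.1–II.1.2] [cite: Garrett2018, §1.8] -/
theorem exists_tsum_indicator_le {C : Set N} (hC : IsCompact C) (hcov : ∀ u : N, ∃ δ : Γ.subgroupOf N, δ • u ∈ C) {K₀ : Set G} (hK₀ : IsCompact K₀) :
    ∃ M : ℝ≥0∞, M < ∞ ∧ ∀ g : G, ∑' q : Γ ⧸ N.subgroupOf Γ, (K₀ * (N : Set G)).indicator (fun _ => (1 : ℝ≥0∞)) (g * (q.out : G)) ≤ M := by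
  have hC' : IsCompact (Subtype.val '' C : Set G) := hC.image continuous_subtype_val
  have hD : IsCompact ((Subtype.val '' C : Set G) * K₀⁻¹ * K₀ * (Subtype.val '' C : Set G)⁻¹) := ((hC'.mul hK₀.inv).mul hK₀).mul hC'.inv
  refine ⟨_, ?_, fun g => tsum_indicator_le_encard Γ N hcov K₀ g⟩
  exact ENat.toENNReal_lt_top.2 (finite_setOf_coe_mem Γ hD).encard_lt_top

end Count

/-! ## §2 Consequences: `θ_{‖Φ‖}` bounded and square-integrable for `‖Φ‖ ≤ 𝟙_{K₀N}` -/

section SquareIntegrable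

variable {G : Type*} [Group G] [TopologicalSpace G] [IsTopologicalGroup G] [T2Space G] (Γ N : Subgroup G) [DiscreteTopology Γ]

omit [TopologicalSpace G] [IsTopologicalGroup G] [T2Space G] [DiscreteTopology Γ] in
/-- ★ F3a's test functions are dominated by indicators of sets compact modulo `N`: for `S ⊆ π_N(K₀)`, `‖(𝟙_S ∘ π_N)(h)‖ ≤ 𝟙_{K₀N}(h)` (if `hN = kN` with `k ∈ K₀`
then `h = k (k⁻¹h) ∈ K₀ N`, Mathlib `QuotientGroup.eq`). [folklore] -/
theorem enorm_indicator_comp_mk_le {K₀ : Set G} {S : Set (G ⧸ N)} (hSK : S ⊆ QuotientGroup.mk '' K₀) (h : G) :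
    ‖S.indicator (fun _ => (1 : ℂ)) (QuotientGroup.mk h : G ⧸ N)‖ₑ ≤ (K₀ * (N : Set G)).indicator (fun _ => (1 : ℝ≥0∞)) h := by
  by_cases hh : (QuotientGroup.mk h : G ⧸ N) ∈ S
  · obtain ⟨k, hk, hkh⟩ := hSK hh
    have hmem : h ∈ K₀ * (N : Set G) := by
      refine Set.mem_mul.2 ⟨k, hk, k⁻¹ * h, QuotientGroup.eq.1 hkh, ?_⟩
      rw [mul_inv_cancel_left]
    rw [Set.indicator_of_mem hh, Set.indicator_of_mem hmem, enorm_one]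
  · rw [Set.indicator_of_notMem hh, enorm_zero]
    exact bot_le

omit [TopologicalSpace G] [IsTopologicalGroup G] [T2Space G] [DiscreteTopology Γ] in
/-- **`θ_{‖Φ‖}(gΓ) ≤ #(Γ ∩ C K₀⁻¹ K₀ C⁻¹)`** for `‖Φ‖ ≤ 𝟙_{K₀N}` pointwise (§1 and monotonicity of `Σ'`). [cite: MoeglinWaldspurger1995, II.1.1–II.1.2] -/
theorem tsum_enorm_le_encard {C : Set N} (hcov : ∀ u : N, ∃ δ : Γ.subgroupOf N, δ • u ∈ C) {K₀ : Set G} {Φ : G → ℂ}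
    (hΦ : ∀ h : G, ‖Φ h‖ₑ ≤ (K₀ * (N : Set G)).indicator (fun _ => (1 : ℝ≥0∞)) h) (g : G) :
    ∑' q : Γ ⧸ N.subgroupOf Γ, ‖Φ (g * (q.out : G))‖ₑ ≤
      (({γ : Γ | (γ : G) ∈ (Subtype.val '' C : Set G) * K₀⁻¹ * K₀ * (Subtype.val '' C : Set G)⁻¹} : Set Γ).encard : ℝ≥0∞) :=
  (ENNReal.tsum_le_tsum fun _ => hΦ _).trans (tsum_indicator_le_encard Γ N hcov K₀ g)

/-- **SQUARE-INTEGRABILITY OF `θ_Φ` FOR `Φ` COMPACTLY SUPPORTED MODULO `N`**: `Γ` discrete, `C ⊆ N` compact with `N = (Γ∩N)·C`, `K₀ ⊆ G` compact, `μ` a FINITE measure on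
`G ⧸ Γ`; then every `Φ : G → ℂ` with `‖Φ‖ ≤ 𝟙_{K₀N}` has `∫⁻_{G⧸Γ} θ_{‖Φ‖}² dμ ≤ M² μ(G⧸Γ) < ∞` — `Φ` belongs to the square-integrable test class of ★ F2b ∕ ★ (H2)-d.
No measurability is needed. [cite: MoeglinWaldspurger1995, II.1.2] [cite: Garrett2018, §1.8] -/
theorem lintegral_tsum_enorm_sq_lt_top [MeasurableSpace (G ⧸ Γ)] (μ : Measure (G ⧸ Γ)) [IsFiniteMeasure μ] {C : Set N} (hC : IsCompact C)
    (hcov : ∀ u : N, ∃ δ : Γ.subgroupOf N, δ • u ∈ C) {K₀ : Set G} (hK₀ : IsCompact K₀) {Φ : G → ℂ}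
    (hΦ : ∀ h : G, ‖Φ h‖ₑ ≤ (K₀ * (N : Set G)).indicator (fun _ => (1 : ℝ≥0∞)) h) :
    ∫⁻ x, (∑' q : Γ ⧸ N.subgroupOf Γ, ‖Φ (x.out * (q.out : G))‖ₑ) ^ 2 ∂μ < ∞ := by
  obtain ⟨M, hM, hbound⟩ := exists_tsum_indicator_le Γ N hC hcov hK₀
  have hle : ∀ x : G ⧸ Γ, (∑' q : Γ ⧸ N.subgroupOf Γ, ‖Φ (x.out * (q.out : G))‖ₑ) ^ 2 ≤ M ^ 2 := fun x =>
    pow_le_pow_left₀ bot_le (((ENNReal.tsum_le_tsum fun _ => hΦ _).trans (hbound x.out))) 2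
  refine lt_of_le_of_lt (lintegral_mono hle) ?_
  rw [lintegral_const]
  exact ENNReal.mul_lt_top (ENNReal.pow_lt_top hM) (measure_lt_top μ _)

end SquareIntegrable

/-! ## §3 Adelic reading: indicators of sets compact modulo `N_i(𝔸)` lie in the square-integrable test class `𝒯_i` -/

section Adelic

variable {K : Type} [Field K] [NumberField K] (𝒢 : AdelicGroupData K)
  [T2Space 𝒢.Adelic] [DiscreteTopology 𝒢.quotientSubgroup] (hQ : 𝒢.quotientSubgroup = 𝒢.arithmeticSubgroup)
  (𝔓 : 𝒢.ParabolicUnipotentData) (i : 𝔓.ι) (μ : Measure 𝒢.automorphicQuotient) [𝒢.IsAutomorphicMeasure μ]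

include hQ in
/-- **`𝟙_{K₀ N_i(𝔸)}`-DOMINATED TEST FUNCTIONS ARE SQUARE-INTEGRABLE ON `X = G(𝔸) ⧸ G(K)`** (`A_G = 1`, `μ` automorphic hence finite, `A_G G(K)` discrete, `N_i(K)`
co-compact in `N_i(𝔸)` in ★ F3b's `hcpt` currency, `K₀ ⊆ G(𝔸)` compact): every `Φ : G(𝔸) → ℂ` with `‖Φ‖ ≤ 𝟙_{K₀ N_i(𝔸)}` satisfies `∫⁻_X θ_{‖Φ‖}² dμ < ∞` — the
square-integrability binder `h2` of ★ F2b `memLp_two_pseudoEisenstein_automorphicQuotient` ∕ ★ (H2)-d's `hF3`.  In particular all of ★ F3a's tests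
`𝟙_S ∘ π_{N_i}`, `S ⊆ π_{N_i}(K₀)` Borel, lie in `𝒯_i` (`enorm_indicator_comp_mk_le`). [cite: MoeglinWaldspurger1995, II.1.2] [cite: BorelJacquet1979, §4.4] -/
theorem adelic_lintegral_tsum_enorm_sq_lt_top (hcpt : ∃ C : Set (𝔓.radical i), IsCompact C ∧ ∀ u : 𝔓.radical i, ∃ l : 𝔓.rational i, l • u ∈ C)
    {K₀ : Set 𝒢.Adelic} (hK₀ : IsCompact K₀) {Φ : 𝒢.Adelic → ℂ}
    (hΦ : ∀ h : 𝒢.Adelic, ‖Φ h‖ₑ ≤ (K₀ * ((𝔓.radical i : Subgroup 𝒢.Adelic) : Set 𝒢.Adelic)).indicator (fun _ => (1 : ℝ≥0∞)) h) :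
    ∫⁻ x, (∑' q : 𝒢.quotientSubgroup ⧸ (𝔓.radical i).subgroupOf 𝒢.quotientSubgroup,
        ‖Φ ((Quotient.out x : 𝒢.Adelic) * ((q.out : 𝒢.quotientSubgroup) : 𝒢.Adelic))‖ₑ) ^ 2 ∂μ < ∞ := by
  letI := AdelicGroupData.measurableSpaceQuotientForm 𝒢
  haveI : @IsFiniteMeasure (𝒢.Adelic ⧸ 𝒢.quotientSubgroup) _ μ := ⟨measure_lt_top μ _⟩
  obtain ⟨C, hC, hcov⟩ := hcpt
  have hcov' : ∀ u : 𝔓.radical i, ∃ δ : (𝒢.quotientSubgroup).subgroupOf (𝔓.radical i), δ • u ∈ C := fun u => by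
    obtain ⟨l, hl⟩ := hcov u
    exact ⟨⟨(l : 𝔓.radical i), by rw [← rational_eq_subgroupOf 𝒢 hQ 𝔓 i]; exact l.2⟩, hl⟩
  exact lintegral_tsum_enorm_sq_lt_top 𝒢.quotientSubgroup (𝔓.radical i) μ hC hcov' hK₀ hΦ

end Adelic

end Summit.HodgeConjecture.HodgeConjecture.Cruxes.H413.K2E1PseudoEisensteinBounded

end
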